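import Summits.CriticalPhenomena.Ising3DConformalLimit.Theses.EnergyNotSigmaSquared
import Literature.Probability.LatticeModels.IntersectionSecondMoment
import Literature.Probability.LatticeModels.ImprovedTreeDiagramBound

/-!
# Skeleton line `dominant-shell-concentration` for crux `RungOneAdjacentMerging`
# (item stmt-CriticalPhenomena-11262, route `EnergyNotSigmaSquared`, rank 5)

LEAD RESHAPE (prover-line-stmt-CriticalPhenomena-11262-0, 2026-08-16, rev L1): the off-chain stub
`stub_branchHarvest` (BranchG milestone) is dropped — the composition never used it; the fuel stub
`stub_harvest` is split at the skeleton level into `stub_harvestInputs` (the four tree facts about the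
critical axis profile and the dyadic bubble, packaged as `HarvestData`) and `stub_abstractHarvest` (a
pure statement about two real sequences; the lead's stub), and `shareHarvest_holds : ShareHarvest` is
now DERIVED from the two (definitional unfolding).  Registered stubs: `stub_chebyshev`,
`stub_boxPassage`, `stub_cells`, `stub_windowRegular`, `stub_harvestInputs`, `stub_abstractHarvest`,
`stub_assembly` (7 = stubs_max); `RungOneAdjacentMerging_of` unchanged in shape.  Namespace moved to
`Summit.CriticalPhenomena.Ising3DConformalLimit.RungOneAdjacentMergingDominantShell` = that of the
route-posited objects file `Theorems/EnergyNotSigmaSquaredRungOneAdjacentMergingDefs.lean` (proposed;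
inlined below until it lands), which every stub file imports.

Crux (fixed, concluded BY NAME below): in the free box `Λ_n ⊂ ℤ³` at `β_c(3)` two independent
sourced double currents `(n₁,n₃) ~ P^{0x,∅}`, `(n₂,n₄) ~ P^{e₂ x+e₂,∅}` have DISJOINT clusters
`C_{n₁+n₃}(0) ∩ C_{n₂+n₄}(e₂) = ∅` with probability `→ 0` as `‖x‖ → ∞` (`n → ∞` first).

## The line (crux-idea card `dominant-shell-concentration`, round 1 ideator 2; triage r1: 3 × pass)

LOG-SCALE CONCENTRATION OF THE POINTWISE-NORMALISED COINCIDENCE COUNT.  With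
`a(u) = G(u)G(x-u)/G(x)` and `a'(u) = a(u - e₂)` the EXACT one-point densities of the two systems
(`G = ⟨σ₀σ_·⟩_{β_c}` on `ℤ³`), the weighted count `N = Σ_u c(u) 𝟙[u ∈ C₁(0)] 𝟙[u ∈ C₂(e₂)]` vanishes on
the disjointness event, so `P[disjoint] ≤ P[N = 0] ≤ E[N²]/E[N]² - 1` (second-moment inequality);
`E[N]` is exact (one-point identity) and `E[N²]` is bounded by ADC21 Prop. A.3 applied once per system
(constant exactly `1`, tree `ecurrentSum_empty_mul_tsum_connInd_mul_connInd_le`) — `stub_chebyshev`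
(any finite graph).  Choosing `c(u) = w_k/(|U_k| a(u)a'(u))` on doubly-toward MMS cone cells `U_k`
(`stub_cells`: `G(x-u) ≥ G(x)` and `G(x-(u-e₂)) ≥ G(x)` for every cell point — the ONE-SIDED far-point
input; no doubling of `G` at scale `‖x‖` is ever used) the normalised pair ratio splits into
* CROSS terms (scales `k ≠ ℓ`): `≤ (1 + (C+1)τ)²` from one-sided P2 at the LARGER scale only
  (`stub_windowRegular`: a doubling WINDOW of the axis two-point function gives
  `G(v-w) ≤ (1 + C‖w‖/2^ℓ)G(v)`, Duminil-Copin–Panis gradient estimate at `d = 3` + MMS detour) and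
  τ-DECAY SEPARATION of the selected scales for the reversed chain ordering (a-priori MMS bounds only);
* DIAGONAL terms (`k = ℓ`, where `d = 3` enters as bubble clumping): `≤ (4/c₀)·w_k²/share(k)`,
  `share(k) = 8^k g(2^{k+2})²/B(2^{k+1})` (MMS sandwich; no regularity at all);
so with `w_k ∝ share(k)` the normalised second moment is `≤ (1+(C+1)τ)² + 4/(c₀ Σ_𝒦 share)`
(`stub_assembly`).  The FUEL is the harvest (`stub_harvestInputs` + `stub_abstractHarvest`):
finite families of windowed, τ-separated scales with `Σ share` as large as desired — automatic under the
card's hypothesis BranchG (infinitely many ρ-dominant dyadic shells; off-chain, dropped in reshape L1),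
and unconditional (lead's proof, reshape L1: `stub_harvestInputs` + `stub_abstractHarvest`; axis log-convexity + MMS +
`B(β_c) = ∞`, tree `NNIsing.bubbleDiagram_criticalBeta_three_eq_top`).  `stub_boxPassage` moves the
infinite-volume weights into the box (`Λ_n ↑ ℤ³` for finitely many two-point functions, free = plus at
`β_c`).  `RungOneAdjacentMerging_of` composes stubs 1–6 into the crux BY NAME (kernel-checked, no sorry).

Triage sharpenings built in: decay separation instead of polynomial index thinning (r1-1 E1 caveat,
r1-2 §0.1: "decay separation is load-bearing"), share-proportional weights so that BranchG is not needed
by the composition (r1-2: "BranchG is removable"), regularity = window only, no P3/P4 (r1-2 notes,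
r1-3 Note H), the wrong "β < β_c ⇒ statement false" remark of the card dropped (r1-3, Ott–Velenik).

## Disproof used (cdisprove v1–v3, evidence notes of 2026-08-15T22:34Z–22:47Z; the file body
`run/gate/evidence/…/20260815T224708Z-Disproof.lean` is not mounted on this compute-free hub)
* `rungOneAdjacentMerging_false_without_farX` (guard `R ≤ ‖x‖` load-bearing, witness `x = 0`) —
  honoured: the line uses the guard at `stub_assembly` (`R = 2^{max 𝒦 + 4}`, the cone aperture of
  `stub_cells` needs `2^{k+4} ≤ ‖x‖`); `x = 0` admits no cell.
* `disjoint_prob_pos` / `disjoint_prob_lt_one` / `not_rungOneAdjacentMerging_eps_zero` (tightness: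
  `0 < D_n(x) < 1`, no `ε = 0` version) — consistent: Chebyshev yields `≤ θ` only for `θ > 0`
  (`η := ε/2 < θ := ε`), never `0`.
* `RungOnePower` / `rungOneAdjacentMerging_of_power` (rate form) — NOT reached: the line's rate is
  `ε(x) ≍ (log log ‖x‖)/log ‖x‖` at best (under BranchG), consistent with the disprover's remark that
  RungOne without a rate does not calibrate `Δ_ε - 2Δ_σ`.
* Ott–Velenik remark (subcritical strands also merge) — does not touch the lever (only sufficiency of
  the critical inputs is claimed); the card's contrary remark is withdrawn in the line card.
No `Negative/` lemma has landed for this crux (`Theorems/RungOneAdjacentMerging/` does not exist); no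
stub is an instance of a refuted statement (`ledger negatives --problem CriticalPhenomena`: 7 entries,
Perc/SAW/Cardy only).
-/

noncomputable section

open MeasureTheory Filter Finset
open scoped BigOperators ENNReal symmDiff
open Literature.Probability.LatticeModels
open Summit.CriticalPhenomena.Ising3DConformalLimit.Theses.EnergyNotSigmaSquared

namespace Summit.CriticalPhenomena.Ising3DConformalLimit.RungOneAdjacentMergingDominantShell

-- BEGIN inline copy of Theorems/EnergyNotSigmaSquaredRungOneAdjacentMergingDefs.lean (replace by the import once it lands)
/-! ### Vocabulary of the line (infinite volume, `d = 3`, `β = β_c(3)`) -/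

/-- The critical two-point function `G(u) = ⟨σ₀σ_u⟩⁺_{β_c(3)}` of `ℤ³` (`= ⟨·⟩^free` at `β_c`,
`twoPointPlus_criticalBeta_eq_twoPointFree_holds`; `> 0`; `c‖u‖⁻² ≤ G(u) ≤ C‖u‖⁻¹`,
`criticalTwoPoint_bounds_holds`; `‖·‖` is the sup norm, `Site.norm_eq_supNorm`). [folklore] -/
abbrev Gc : Site 3 → ℝ := criticalTwoPoint 3

/-- The second nail `e₂ = (0,1,0)` (the crux's `Pi.single 1 1`). [folklore] -/
def e₂ : Site 3 := Pi.single 1 1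

/-- The axis two-point function `g(m) = G(m e₁)` (antitone in `m` by Messager–Miracle-Solé; by MMS
`g(‖u‖₁) ≤ G(u) ≤ g(‖u‖_∞)`). [folklore] -/
def axisG (m : ℕ) : ℝ := Gc (Pi.single 0 (m : ℤ))

/-- The truncated bubble `B(L) = Σ_{‖y‖_∞ ≤ L} G(y)²` (tree `bubbleDiagram`; `B(2^k) → ∞`,
Duminil-Copin–Panis 2025 Thm 1.8, tree `NNIsing.bubbleDiagram_criticalBeta_three_eq_top`). [cite: AizenmanDuminilCopinAnnals2021, arXiv:1912.07973 Thm 1.3, definition of B_L(β) (p. 6)] -/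
def Bub (L : ℝ) : ℝ := bubbleDiagram (criticalTwoPoint 3) L

/-- The exact one-point density of the sourced system `0 → x` at `u`:
`P^{0x,∅}[u ∈ C(0)] = G(u)G(x-u)/G(x)` (tree `tsum_epairWeight_mul_indicator_mem_cluster`, in the
infinite-volume limit). The system `e₂ → x+e₂` has density `dens x (u - e₂)`. [cite: AizenmanDuminilCopinAnnals2021, arXiv:1912.07973 §4.2, proof of Lemma 4.4 (first moment)] -/
def dens (x u : Site 3) : ℝ := Gc u * Gc (x - u) / Gc x

/-- The infinite-volume two-step bound of ADC21 Prop. A.3 for the system `0 → x` at the pair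
`(u, v)`: `G(u)G(v-u)G(x-v) + G(v)G(u-v)G(x-u)` (tree `Current.twoStepBound`, normalised by `Z[∅]³`).
The system `e₂ → x+e₂` has `tstep x (u - e₂) (v - e₂)`. [cite: AizenmanDuminilCopinAnnals2021, arXiv:1912.07973 Appendix A.2, Proposition A.3] -/
def tstep (x u v : Site 3) : ℝ := Gc u * Gc (v - u) * Gc (x - v) + Gc v * Gc (u - v) * Gc (x - u)

/-- INFINITE-VOLUME WEIGHTS at level `η` for the far point `x`: nonnegative weights `c` on a finite
set `U` whose weighted coincidence count has (normalised) second moment at most `1 + η` times the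
squared mean — `Σ_{u,v} c c T₁T₂ ≤ (1+η)·G(x)²·(Σ_u c a a')²`, mean positive. [cite: AizenmanDuminilCopinAnnals2021, arXiv:1912.07973 §6.2 (6.5) (second-moment method)] -/
def InfVolWeights (η : ℝ) (x : Site 3) : Prop :=
  ∃ (U : Finset (Site 3)) (c : Site 3 → ℝ), (∀ u, 0 ≤ c u) ∧
    0 < ∑ u ∈ U, c u * (dens x u * dens x (u - e₂)) ∧
    ∑ u ∈ U, ∑ v ∈ U, c u * c v * (tstep x u v * tstep x (u - e₂) (v - e₂)) ≤
      (1 + η) * Gc x ^ 2 * (∑ u ∈ U, c u * (dens x u * dens x (u - e₂))) ^ 2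

/-- A doubling WINDOW of the axis two-point function around the dyadic scale `ℓ` (eight dyadic
scales, constant `A`): `g(2^{ℓ-4}) ≤ A·g(2^{ℓ+4})`. [folklore] -/
def HasWindow (A : ℝ) (ℓ : ℕ) : Prop := axisG (2 ^ (ℓ - 4)) ≤ A * axisG (2 ^ (ℓ + 4))

/-- The (axis form of the) bubble SHARE of scale `ℓ`: `8^ℓ g(2^{ℓ+2})² / B(2^{ℓ+1})` — the inverse of
the diagonal (same-scale) clumping ratio of a cone cell at scale `ℓ`. [folklore] -/
def share (ℓ : ℕ) : ℝ := 8 ^ ℓ * axisG (2 ^ (ℓ + 2)) ^ 2 / Bub (2 ^ (ℓ + 1))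

/-- `share ℓ ≥ 0` (a quotient of a square by a sum of squares). [folklore] -/
theorem share_nonneg : ∀ ℓ : ℕ, 0 ≤ share ℓ := fun _ =>
  div_nonneg (mul_nonneg (pow_nonneg (by norm_num) _) (sq_nonneg _)) (bubbleDiagram_nonneg _ _)

/-- `B(L) ≥ 0`. [folklore] -/
theorem Bub_nonneg (L : ℝ) : 0 ≤ Bub L := bubbleDiagram_nonneg _ _

/-! ### Vocabulary of the line (finite volume: any finite graph, uniform coupling `β`) -/

section FiniteVolume

variable {V : Type} [Fintype V] [DecidableEq V] (G : SimpleGraph V) [DecidableRel G.Adj]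

/-- Un-normalised weighted MEAN of the coincidence count of the two systems `o → y`, `a → y'`:
`Σ_u c(u) · Z[ou]Z[uy] · Z[au]Z[uy']` (`= Z[oy]Z[ay']Z[∅]² · E[N]`, one-point identity twice). [cite: AizenmanDuminilCopinAnnals2021, arXiv:1912.07973 §4.2, proof of Lemma 4.4 (first moment of |𝓜|)] -/
def fvMean (β : ℝ) (o a y y' : V) (c : V → ℝ≥0∞) : ℝ≥0∞ :=
  ∑ u, c u * ((ecurrentSum (fun _ : ↥G.edgeFinset => β) ({o} ∆ {u}) *
      ecurrentSum (fun _ : ↥G.edgeFinset => β) ({u} ∆ {y})) *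
    (ecurrentSum (fun _ : ↥G.edgeFinset => β) ({a} ∆ {u}) *
      ecurrentSum (fun _ : ↥G.edgeFinset => β) ({u} ∆ {y'})))

/-- Un-normalised weighted SECOND-MOMENT BOUND: `Σ_{u,v} c(u)c(v) B_{oy}(u,v) B_{ay'}(u,v)` with ADC21's
two-step bounds (`≥ Z[oy]Z[ay']Z[∅]⁴ · E[N²]`, Prop. A.3 once per system). [cite: AizenmanDuminilCopinAnnals2021, arXiv:1912.07973 §4.2, proof of Lemma 4.4 (second moment of |𝓜|)] -/
def fvSecond (β : ℝ) (o a y y' : V) (c : V → ℝ≥0∞) : ℝ≥0∞ :=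
  ∑ u, ∑ v, c u * c v *
    (Current.twoStepBound (fun _ : ↥G.edgeFinset => β) o y u v *
      Current.twoStepBound (fun _ : ↥G.edgeFinset => β) a y' u v)

/-- FINITE-VOLUME SECOND-MOMENT DATA at level `θ`: weights whose mean is finite and nonzero and whose
(normalised) second-moment bound is at most `(1+θ)·mean²`:
`Z[oy]·Z[ay']·fvSecond ≤ (1+θ)·fvMean²`. [folklore] -/
def SecondMomentData (β θ : ℝ) (o a y y' : V) : Prop :=
  ∃ c : V → ℝ≥0∞, fvMean G β o a y y' c ≠ 0 ∧ fvMean G β o a y y' c ≠ ∞ ∧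
    ecurrentSum (fun _ : ↥G.edgeFinset => β) ({o} ∆ {y}) *
        ecurrentSum (fun _ : ↥G.edgeFinset => β) ({a} ∆ {y'}) * fvSecond G β o a y y' c ≤
      ENNReal.ofReal (1 + θ) * fvMean G β o a y y' c ^ 2

end FiniteVolume

/-! ### The STATEMENTS of the registered stubs of the line (named `Prop`s; the skeleton's
`Registered.stub_*` aliases and `RungOneAdjacentMerging_of` consume them by these names) -/

/-- Statement of STUB 1 (mean-one Chebyshev for the duplicated two-centre system, any finite graph). -/
def MeanOneChebyshev : Prop :=
  ∀ (V : Type) [Fintype V] [DecidableEq V] (G : SimpleGraph V) [DecidableRel G.Adj] (β : ℝ), 0 ≤ β →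
    ∀ θ : ℝ, 0 ≤ θ → ∀ o a y y' : V, SecondMomentData G β θ o a y y' →
      ((doubleCurrentMeasure G β ({o} ∆ {y}) ∅).prod (doubleCurrentMeasure G β ({a} ∆ {y'}) ∅)).real
          {pq | ∀ u : V, ¬ (pq.1 ∈ tracedConn G o u ∧ pq.2 ∈ tracedConn G a u)} ≤ θ

/-- Statement of STUB 2 (box passage `Λ_n ↑ ℤ³` of the weights). -/
def BoxPassage : Prop :=
  ∀ (x : Site 3) (η θ : ℝ), 0 < η → η < θ → InfVolWeights η x →
    ∃ n₀ : ℕ, ∀ n : ℕ, n₀ ≤ n → ∀ o a y y' : ↥(box 3 n),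
      (o : Site 3) = 0 → (a : Site 3) = Pi.single 1 1 → (y : Site 3) = x →
      (y' : Site 3) = x + Pi.single 1 1 →
        SecondMomentData ((zdGraph 3).comap (Subtype.val : ↥(box 3 n) → Site 3))
          (criticalBeta 3) θ o a y y'

/-- Statement of STUB 3 (doubly-toward Messager–Miracle-Solé cone cells). -/
def TowardCells : Prop :=
  ∃ c₀ : ℝ, 0 < c₀ ∧ ∀ k : ℕ, 4 ≤ k → ∀ x : Site 3, (2 : ℝ) ^ (k + 4) ≤ ‖x‖ →
    ∃ U : Finset (Site 3), c₀ * 8 ^ k ≤ (U.card : ℝ) ∧ ∀ u ∈ U,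
      (2 : ℝ) ^ (k - 1) ≤ ‖u‖ ∧ ‖u‖ ≤ (2 : ℝ) ^ k ∧
      Gc x ≤ Gc (x - u) ∧ Gc x ≤ Gc (x - (u - e₂)) ∧
      axisG (2 ^ (k + 2)) ≤ Gc u ∧ axisG (2 ^ (k + 2)) ≤ Gc (u - e₂)

/-- Statement of STUB 4 (one-sided P2 from a doubling window, `d = 3`). -/
def WindowRegular : Prop :=
  ∀ A : ℝ, 1 ≤ A → ∃ C : ℝ, 0 ≤ C ∧ ∀ ℓ : ℕ, 4 ≤ ℓ → HasWindow A ℓ →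
    ∀ v w : Site 3, (2 : ℝ) ^ (ℓ - 2) ≤ ‖v‖ → ‖v‖ ≤ (2 : ℝ) ^ (ℓ + 1) → 16 * ‖w‖ ≤ (2 : ℝ) ^ ℓ →
      Gc (v - w) ≤ (1 + C * ‖w‖ / 2 ^ ℓ) * Gc v

/-- **Abstract harvest data**: the four tree inputs of the share harvest, stated
for two real sequences `a` (the dyadic axis values `g(2^j)`) and `B` (the dyadic bubbles `B(2^k)`):
`a > 0` antitone and `→ 0` (Messager–Miracle-Solé + infrared bound), DYADIC LOG-CONVEXITY
`a_{j+1}³ ≤ a_j² a_{j+2}` (the ramp constraint `θ_{j+1} ≤ 2θ_j`, from axis log-convexity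
`g(n)² ≤ g(n-1)g(n+1)`, tree `TwoPointLogConvex.axisForm_sq_le` at `m*(β_c) = 0`), `B > 0`
non-decreasing and `→ ∞` (Duminil-Copin–Panis 2025 Thm 1.8, tree
`NNIsing.bubbleDiagram_criticalBeta_three_eq_top`), and the MMS SHELL SANDWICH
`7·8^k a_{k+2}² ≤ B_k - B_{k-1} ≤ 19·8^k a_{k-1}²` (`k ≥ 1`; the dyadic shell
`2^{k-1} < ‖z‖_∞ ≤ 2^k` has between `7·8^k` and `19·8^k` points, on it
`g(2^{k+2}) ≤ G(z) ≤ g(2^{k-1})` by `twoPointPlus_le_of_mul_supNorm_le` /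
`twoPointPlus_le_axis_of_mem_sphere`). -/
structure HarvestData (a B : ℕ → ℝ) : Prop where
  a_pos : ∀ j, 0 < a j
  a_anti : Antitone a
  a_tendsto : Tendsto a atTop (nhds 0)
  a_logConvex : ∀ j, a (j + 1) ^ 3 ≤ a j ^ 2 * a (j + 2)
  B_pos : 0 < B 0
  B_mono : Monotone B
  B_tendsto : Tendsto B atTop atTop
  shell_lower : ∀ k, 1 ≤ k → 7 * 8 ^ k * a (k + 2) ^ 2 ≤ B k - B (k - 1)
  shell_upper : ∀ k, 1 ≤ k → B k - B (k - 1) ≤ 19 * 8 ^ k * a (k - 1) ^ 2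

/-- Statement of STUB 5a (the harvest inputs hold for the critical axis profile and bubble). -/
def HarvestInputs : Prop :=
  HarvestData (fun j => axisG (2 ^ j)) (fun k => Bub (2 ^ k))

/-- Statement of STUB 5b (the abstract harvest: windowed, τ-separated scales with unbounded share,
for ANY pair of sequences obeying `HarvestData`). -/
def AbstractHarvest : Prop :=
  ∀ a B : ℕ → ℝ, HarvestData a B →
    ∃ A : ℝ, 1 ≤ A ∧ ∀ τ : ℝ, 0 < τ → ∀ (k₀ : ℕ) (M : ℝ), ∃ 𝒦 : Finset ℕ,
      (∀ k ∈ 𝒦, k₀ ≤ k ∧ a (k - 4) ≤ A * a (k + 4)) ∧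
      (∀ k ∈ 𝒦, ∀ ℓ ∈ 𝒦, k < ℓ → a (ℓ - 2) ≤ τ * a (k + 2) ∧ (2 : ℝ) ^ (k + 1) ≤ τ * 2 ^ ℓ) ∧
      M ≤ ∑ k ∈ 𝒦, (8 : ℝ) ^ k * a (k + 2) ^ 2 / B (k + 1)

/-- SHARE HARVEST (harvest of bubble share along windowed, decay-separated scales; derived in the
skeleton from STUBS 5a + 5b by unfolding). -/
def ShareHarvest : Prop :=
  ∃ A : ℝ, 1 ≤ A ∧ ∀ τ : ℝ, 0 < τ → ∀ (k₀ : ℕ) (M : ℝ), ∃ 𝒦 : Finset ℕ,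
    (∀ k ∈ 𝒦, k₀ ≤ k ∧ HasWindow A k) ∧
    (∀ k ∈ 𝒦, ∀ ℓ ∈ 𝒦, k < ℓ →
      axisG (2 ^ (ℓ - 2)) ≤ τ * axisG (2 ^ (k + 2)) ∧ (2 : ℝ) ^ (k + 1) ≤ τ * 2 ^ ℓ) ∧
    M ≤ ∑ k ∈ 𝒦, share k

/-- The infinite-volume VARIANCE BOUND (conclusion of STUB 6): for every `η > 0`, beyond some radius
every far point `x` admits infinite-volume weights at level `η`. -/
def VarianceBound : Prop :=
  ∀ η : ℝ, 0 < η → ∃ R : ℝ, ∀ x : Site 3, R ≤ ‖x‖ → InfVolWeights η x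

/-- Statement of STUB 6 (assembly of the variance bound from cells, windows and the harvest). -/
def Assembly : Prop := TowardCells → WindowRegular → ShareHarvest → VarianceBound

-- END inline copy of the Defs file

/-! ### The registered stubs -/

/-- STUB 1 (M) — MEAN-ONE CHEBYSHEV for the duplicated two-centre system on ANY finite graph with
uniform coupling `β ≥ 0`: if weights `c ≥ 0` on the vertices satisfy
`Z[oy]Z[ay']·fvSecond ≤ (1+θ)·fvMean²` (`0 < fvMean < ∞`), then
`P^{oy,∅} ⊗ P^{ay',∅}[no u with o ↔ u in n₁+n₃ and a ↔ u in n₂+n₄] ≤ θ`.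
Proof route (all inputs in tree): the event is `{N = 0}`-contained for
`N = Σ_u c(u)𝟙[u ∈ C_{n₁+n₃}(o)]𝟙[u ∈ C_{n₂+n₄}(a)]` (`mem_tracedConn_iff` / `Current.mem_cluster_iff`);
`E[N] = fvMean/(Z[oy]Z[ay']Z[∅]²)` by `tsum_epairWeight_mul_indicator_mem_cluster` twice;
`E[N²] ≤ fvSecond/(Z[oy]Z[ay']Z[∅]⁴)` by `ecurrentSum_empty_mul_tsum_connInd_mul_connInd_le` (Prop. A.3,
constant 1) once per system and Fubini (`tsum_prodWeight_mul_mul` pattern with two centres);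
`P[N = 0] ≤ 1 - E[N]²/E[N²] ≤ θ/(1+θ)` by `tsum_mul_sq_le_tsum_indicator_mul_tsum_sq`; measure ↔
current sums by `doubleCurrentMeasure_real_mul`, `pairWeight`/`epairWeight` with `K ≡ β`
(`Current.weight_eq_wweight`, `ecurrentSum_eq_ofReal`), `Measure.prod` on the countable discrete type
of currents. Degenerate `Z[oy] = 0` makes the measure `0` and the bound trivial. -/
theorem stub_chebyshev :
    ∀ (V : Type) [Fintype V] [DecidableEq V] (G : SimpleGraph V) [DecidableRel G.Adj] (β : ℝ), 0 ≤ β →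
      ∀ θ : ℝ, 0 ≤ θ → ∀ o a y y' : V, SecondMomentData G β θ o a y y' →
        ((doubleCurrentMeasure G β ({o} ∆ {y}) ∅).prod (doubleCurrentMeasure G β ({a} ∆ {y'}) ∅)).real
            {pq | ∀ u : V, ¬ (pq.1 ∈ tracedConn G o u ∧ pq.2 ∈ tracedConn G a u)} ≤ θ := by
  sorry

/-- STUB 2 (M) — BOX PASSAGE: infinite-volume weights at level `η` for `x` yield, for all large `n`,
finite-volume second-moment data at any level `θ > η` on the free box graph
`(zdGraph 3).comap Subtype.val` on `↥(box 3 n)` with nails `o = 0, a = e₂, y = x, y' = x + e₂`.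
Proof route: `Z[{p}∆{q}]/Z[∅] = ⟨σ_pσ_q⟩^free_{Λ_n;β_c}` (`isingTwoPoint_free_eq_currentSum_div_holds`
on the box graph + `isingCorr_free_map` along `Subtype.val`, adjacency `Iff.rfl`; `ecurrentSum_eq_ofReal`,
`ecurrentSum_ne_top`); `⟨σ_pσ_q⟩^free_{Λ_n;β_c} → twoPointFree 3 β_c (q - p) = G(q - p)`
(`tendsto_isingTwoPoint_box_sub`, `twoPointPlus_criticalBeta_eq_twoPointFree_holds`); finitely many
pairs (`U ∪ {0, e₂, x, x+e₂}` finite), `fvMean/Z[∅]⁴ → G(x)²·Σ c a a' > 0`,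
`fvSecond/Z[∅]⁶ → Σ c c T₁T₂`, `Z[0x]Z[e₂ x+e₂]/Z[∅]² → G(x)²`; strict room `η < θ` and continuity give the
inequality eventually; weights transported as `c ∘ Subtype.val` (support inside the box eventually,
`eventually_mem_box`). -/
theorem stub_boxPassage :
    ∀ (x : Site 3) (η θ : ℝ), 0 < η → η < θ → InfVolWeights η x →
      ∃ n₀ : ℕ, ∀ n : ℕ, n₀ ≤ n → ∀ o a y y' : ↥(box 3 n),
        (o : Site 3) = 0 → (a : Site 3) = Pi.single 1 1 → (y : Site 3) = x →
        (y' : Site 3) = x + Pi.single 1 1 →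
          SecondMomentData ((zdGraph 3).comap (Subtype.val : ↥(box 3 n) → Site 3))
            (criticalBeta 3) θ o a y y' := by
  sorry

/-- STUB 3 (M) — DOUBLY-TOWARD MMS CONE CELLS: for `k ≥ 4` and every `x` with `‖x‖_∞ ≥ 2^{k+4}` there
is a set `U` of at least `c₀ 8^k` lattice points in the shell `2^{k-1} ≤ ‖u‖_∞ ≤ 2^k` such that for
every `u ∈ U` BOTH `u` and `u - e₂` lie in the toward-cone of `x`: `G(x - u) ≥ G(x)` and
`G(x - (u - e₂)) ≥ G(x)` (the one-sided far-point tilt — NO regularity of `G` at scale `‖x‖`), and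
`G(u), G(u - e₂) ≥ g(2^{k+2})` (MMS, `twoPointPlus_le_of_mul_supNorm_le` with `3·2^k ≤ 2^{k+2}`).
Construction: `i₀` a dominant coordinate of `x`, signs `s = sgn x`; `U = {u : s_{i₀}u_{i₀} ∈ [2^{k-1},2^k],
|u_l| ≤ 2^{k-3}, s_l u_l ≥ 0 (l ≠ i₀, x_l ≠ 0)}` adjusted by one unit in coordinate `1` for the shift
`e₂`; toward-cone monotonicity = the MMS move sequence of card `toward-cone-chebyshev`
(`TowardConeMonotone`, verified by triage r1-2/r1-3: diagonal moves `messager_miracleSole_diag_holds`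
for the small coordinates, axis moves `messager_miracleSole_holds`, reflections
`twoPointPlus_reflection_invariant_holds`; aperture `4‖w‖₁ ≤ ‖x‖_∞` from `2^{k+4} ≤ ‖x‖`);
`|U| ≥ 2^{k-1}·(2^{k-3})² = 8^k/128`. -/
theorem stub_cells :
    ∃ c₀ : ℝ, 0 < c₀ ∧ ∀ k : ℕ, 4 ≤ k → ∀ x : Site 3, (2 : ℝ) ^ (k + 4) ≤ ‖x‖ →
      ∃ U : Finset (Site 3), c₀ * 8 ^ k ≤ (U.card : ℝ) ∧ ∀ u ∈ U,
        (2 : ℝ) ^ (k - 1) ≤ ‖u‖ ∧ ‖u‖ ≤ (2 : ℝ) ^ k ∧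
        Gc x ≤ Gc (x - u) ∧ Gc x ≤ Gc (x - (u - e₂)) ∧
        axisG (2 ^ (k + 2)) ≤ Gc u ∧ axisG (2 ^ (k + 2)) ≤ Gc (u - e₂) := by
  sorry

/-- STUB 4 (M/L) — ONE-SIDED P2 FROM A DOUBLING WINDOW (the `d = 3` re-run of the P2 part of ADC21
Prop. 5.9 / Def. 5.11, tree `RegularScales` Part D `p2_of_growth` is the `d = 4` instance): if
`g(2^{ℓ-4}) ≤ A g(2^{ℓ+4})` then for `2^{ℓ-2} ≤ ‖v‖_∞ ≤ 2^{ℓ+1}` and `‖w‖_∞ ≤ 2^{ℓ-4}`,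
`G(v - w) ≤ (1 + C_A ‖w‖_∞/2^ℓ) G(v)`.  Proof route: `ℓ¹` path from `v` to `v - w` (`≤ 3‖w‖_∞` unit
steps, hull inside `3·2^{ℓ-4} ≤ ‖z‖_∞ ≤ 33·2^{ℓ-4}`, `abs_sub_le_mul_l1Dist_of_steps`); a step along a
dominant coordinate costs `≤ g(2^{ℓ-4})/2^{ℓ-3}` by the DCP gradient estimate
`twoPointFree_criticalBeta_gradient_estimate` (`d = 3 ≥ 3`, `j = 2^{ℓ-4}`) and MMS; a step along a small
coordinate is squeezed between two dominant-coordinate steps by the diagonal MMS inequality twice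
(`two_sided_step` pattern); `G ≥ g(‖·‖₁) ≥ g(2^{ℓ+4})` on the hull; whence `C_A = 24A`.  Why it might
fail: only through an index slip — every input is a theorem of the tree at `d = 3`. -/
theorem stub_windowRegular :
    ∀ A : ℝ, 1 ≤ A → ∃ C : ℝ, 0 ≤ C ∧ ∀ ℓ : ℕ, 4 ≤ ℓ → HasWindow A ℓ →
      ∀ v w : Site 3, (2 : ℝ) ^ (ℓ - 2) ≤ ‖v‖ → ‖v‖ ≤ (2 : ℝ) ^ (ℓ + 1) → 16 * ‖w‖ ≤ (2 : ℝ) ^ ℓ →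
        Gc (v - w) ≤ (1 + C * ‖w‖ / 2 ^ ℓ) * Gc v := by
  sorry

/-- STUB 5a (M) — HARVEST INPUTS: the critical axis profile `a_j = g(2^j) = G(2^j e₁)` and the dyadic
bubble `B_k = B(2^k)` of `G = criticalTwoPoint 3` satisfy `HarvestData`.  Proof route (all inputs in
tree): `a_pos` from `criticalTwoPoint_bounds_holds` (lower bound `c‖x‖⁻² > 0`); `a_anti` from the axis
Messager–Miracle-Solé inequality iterated (`messager_miracleSole_holds`, cf. `twoPointPlus_add_single_le`
in `SharpnessProofs`); `a_tendsto` from the infrared upper bound `G ≤ C‖x‖⁻¹`; `a_logConvex`: with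
`φ = log g` on `ℕ`, `axisForm_sq_le` (one Dirac mass, `m*(β_c) = 0` by
`spontaneousMagnetization_criticalBeta_eq_zero_holds`) gives `g(n)² ≤ g(n-1)g(n+1)`, so the increments
of `φ` are non-decreasing and `(r-q)(φ q - φ p) ≤ (q-p)(φ r - φ q)` for `p < q < r`; take
`(p,q,r) = (2^j, 2^{j+1}, 2^{j+2})`; `B_pos` from `sq_apply_zero_le_bubbleDiagram` (`G(0) = 1`);
`B_mono` = `bubbleDiagram_mono`; `B_tendsto`: `NNIsing.bubbleDiagram_criticalBeta_three_eq_top`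
(`Σ' ofReal (twoPointFree 3 β_c x)² = ⊤`) with `twoPointPlus_criticalBeta_eq_twoPointFree_holds`
(`criticalTwoPoint 3 = twoPointFree 3 (criticalBeta 3)`) and `latticeBox 3 (2^k) ↑ ℤ³`; shell bounds:
`latticeBox 3 (2^k) \ latticeBox 3 (2^{k-1})` has `(2^{k+1}+1)³ - (2^k+1)³ ∈ [7·8^k, 19·8^k]` points
(`latticeBox_eq_box`, `card` of `box 3 n = (2n+1)³`), and on it `g(2^{k+2}) ≤ G(z) ≤ g(2^{k-1})`
(`twoPointPlus_le_of_mul_supNorm_le` with `3·2^k ≤ 2^{k+2}`; `twoPointPlus_le_axis_of_mem_sphere` +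
axis monotonicity, `‖z‖_∞ ≥ 2^{k-1}+1`). -/
theorem stub_harvestInputs : HarvestData (fun j => axisG (2 ^ j)) (fun k => Bub (2 ^ k)) := by
  sorry

/-- STUB 5b (L, the FUEL, lead's stub) — ABSTRACT SHARE HARVEST: for sequences `a, B` with
`HarvestData a B` there is ONE window constant `A ≥ 1` such that for every `τ > 0`, floor `k₀` and
target `M` some finite family `𝒦` of scales `≥ k₀` is `A`-windowed (`a_{k-4} ≤ A a_{k+4}`), pairwise
τ-decay-separated (`a_{ℓ-2} ≤ τ a_{k+2}` and `2^{k+1} ≤ τ 2^ℓ` for `k < ℓ`) and has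
`Σ_𝒦 8^k a_{k+2}²/B_{k+1} ≥ M`.  Proof (lead, NOTES.md "Harvest mathematics"): with
`share k = 8^k a_{k+2}²/B_{k+1} ≤ 1/7` and `B_{k+1} ≤ 1391 B_k` (shell sandwich),
(1) `Σ share = ∞` (Abel–Dini on `B → ∞`: `(B_{k+3}-B_{k+2})/B_{k+3} ≤ 19·512·share k`);
(2) ANCESTOR LEMMA: if `k ≥ 6` is not `A`-windowed then `share k ≤ ε₀ · share k'` for some
`k' ∈ [k-6, k-1]`, `ε₀ = 8·A^{-1/16}` — a drop `a_j/a_{j+1} > A^{1/8}` at `j ≤ k+1` is seen by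
`a_{k+2}` directly, at `j ∈ {k+2, k+3}` it forces `a_{k+1}/a_{k+2} > A^{1/32}` by dyadic log-convexity;
hence `Σ_{windowed} share = ∞` once `6ε₀ ≤ 1/2` (`A = 2^{112}`); (3) THINNING: greedy chain
`m_{i+1} = min{ℓ > m_i+4 : a_{ℓ-2} ≤ τ a_{m_i+2}}`; one windowed scale from every other block is
τ-decay-separated; `Σ_i max_{windowed ∩ block i} share = ∞` by a saturation dichotomy inside the
τ-flat blocks (subcritical part geometric with ratio `≥ 4`, saturated scales have share `≥ τ²/1728`,
all but `8 log₂(1/τ)/log₂ A + 8` scales of a flat block are windowed, every other scale traced to a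
windowed ancestor with factor `ε₀^s` and index drift `≤ 6s`); index separation by pigeonhole on
`k mod ⌈1 + log₂(1/τ)⌉` at the end. [folklore] -/
theorem stub_abstractHarvest :
    ∀ a B : ℕ → ℝ, HarvestData a B →
      ∃ A : ℝ, 1 ≤ A ∧ ∀ τ : ℝ, 0 < τ → ∀ (k₀ : ℕ) (M : ℝ), ∃ 𝒦 : Finset ℕ,
        (∀ k ∈ 𝒦, k₀ ≤ k ∧ a (k - 4) ≤ A * a (k + 4)) ∧
        (∀ k ∈ 𝒦, ∀ ℓ ∈ 𝒦, k < ℓ → a (ℓ - 2) ≤ τ * a (k + 2) ∧ (2 : ℝ) ^ (k + 1) ≤ τ * 2 ^ ℓ) ∧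
        M ≤ ∑ k ∈ 𝒦, (8 : ℝ) ^ k * a (k + 2) ^ 2 / B (k + 1) := by
  sorry

/-- SHARE HARVEST, derived (was the registered stub `stub_harvest` of the planner's skeleton): the
abstract harvest applied to the harvest inputs is `ShareHarvest` verbatim (`HasWindow A k` unfolds to
`a (k-4) ≤ A * a (k+4)` and `share k` to `8^k a(k+2)²/B(k+1)` for `a j = axisG (2^j)`,
`B k = Bub (2^k)`). [folklore] -/
theorem shareHarvest_of (hI : HarvestInputs) (hA : AbstractHarvest) : ShareHarvest := by
  obtain ⟨A, hA1, h⟩ := hA _ _ hI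
  refine ⟨A, hA1, fun τ hτ k₀ M => ?_⟩
  obtain ⟨𝒦, hw, hsep, hM⟩ := h τ hτ k₀ M
  refine ⟨𝒦, fun k hk => ⟨(hw k hk).1, ?_⟩, fun k hk ℓ hℓ hkℓ => hsep k hk ℓ hℓ hkℓ, ?_⟩
  · simpa [HasWindow] using (hw k hk).2
  · simpa [share] using hM

/-- STUB 6 (M, LOAD-BEARING COMPUTATION) — ASSEMBLY OF THE VARIANCE BOUND ("constant exactly 1"):
given cells, window-regularity and the harvest, for every `η > 0` there is `R` such that every `x` with
`‖x‖ ≥ R` carries infinite-volume weights at level `η`.  Proof route: take `C = C_A` from STUB 4 for the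
harvest's `A`; `τ = min(1/16, η/(8(C+1)))`, `M = 16/(c₀η)`, `k₀ = 4`; the family `𝒦` of STUB 5;
`R = 2^{max 𝒦 + 4}`; cells `U_k` (STUB 3) for `k ∈ 𝒦` (disjoint: index gaps `≥ 5`); weights
`c(u) = w_k/(|U_k|·dens x u·dens x (u-e₂))`, `w_k = share(k)/Σ_𝒦 share`, so the mean is `1`.  With
`R(u,v) := tstep/(G(x)·dens·dens) = G(v-u)G(x)/(G(v)G(x-u)) + G(u-v)G(x)/(G(u)G(x-v))` and the cone
inequalities of STUB 3, `R ≤ G(v-u)/G(v) + G(u-v)/G(u)` (same for the `e₂`-shifted system).  CROSS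
(`k < ℓ`): `G(v-u)/G(v) ≤ 1 + C 2^{k+1}/2^ℓ ≤ 1 + Cτ` (STUB 4 at the larger scale; `v, v-e₂` in range,
`16‖u‖, 16‖u-e₂‖ ≤ 2^ℓ` from the index gap) and `G(u-v)/G(u) ≤ g(2^{ℓ-2})/g(2^{k+2}) ≤ τ` (MMS
`G ≤ g(‖·‖_∞)`, `‖u-v‖_∞ ≥ 2^{ℓ-2}`, cells' lower bound; decay separation) — so `R R' ≤ (1+(C+1)τ)²`;
DIAGONAL (`k = ℓ`): `R R' ≤ 4G(u-v)²/g(2^{k+2})²`, `Σ_{u,v∈U_k} G(u-v)² ≤ |U_k| B(2^{k+1})`, so the block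
is `≤ (4/c₀) w_k²/share(k)`; total `≤ (1+(C+1)τ)² + 4/(c₀ Σ_𝒦 share) ≤ 1 + η` (for `η ≤ 16`; larger `η`
by monotonicity).  Tree inputs: `criticalTwoPoint_bounds_holds` (positivity), MMS axis/sup-norm bounds
(`twoPointPlus_le_axis_of_mem_sphere`, `twoPointPlus_le_of_mul_supNorm_le`), reflection symmetry
`G(-y) = G(y)`, `bubbleDiagram_def`.  This is where the card's cheapest falsifier (1) lives: every far-point
factor enters one-sidedly as `G(x)/G(x-u) ≤ 1`. -/
theorem stub_assembly : TowardCells → WindowRegular → ShareHarvest →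
    ∀ η : ℝ, 0 < η → ∃ R : ℝ, ∀ x : Site 3, R ≤ ‖x‖ → InfVolWeights η x := by
  sorry

/-! ### Consistency: each named statement IS its registered stub (definitionally) -/

theorem meanOneChebyshev_holds : MeanOneChebyshev := stub_chebyshev
theorem boxPassage_holds : BoxPassage := stub_boxPassage
theorem towardCells_holds : TowardCells := stub_cells
theorem windowRegular_holds : WindowRegular := stub_windowRegular
theorem harvestInputs_holds : HarvestInputs := stub_harvestInputs
theorem abstractHarvest_holds : AbstractHarvest := stub_abstractHarvest
theorem shareHarvest_holds : ShareHarvest := shareHarvest_of stub_harvestInputs stub_abstractHarvest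
theorem assembly_holds : Assembly := stub_assembly

/-! ### Name-keyed aliases of the statements (the hypotheses of the composition)

`Registered.stub_X` is the statement of the registered stub `stub_X` under that short name, so that the
native skeleton audit (`#h21_check_skeleton`: hypotheses admissible iff registered stubs BY NAME)
accepts `RungOneAdjacentMerging_of : Registered.stub_chebyshev → … → RungOneAdjacentMerging`. -/
namespace Registered

/-- Alias of `MeanOneChebyshev` keyed by the registered stub name. -/
abbrev stub_chebyshev : Prop := MeanOneChebyshev
/-- Alias of `BoxPassage` keyed by the registered stub name. -/
abbrev stub_boxPassage : Prop := BoxPassage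
/-- Alias of `TowardCells` keyed by the registered stub name. -/
abbrev stub_cells : Prop := TowardCells
/-- Alias of `WindowRegular` keyed by the registered stub name. -/
abbrev stub_windowRegular : Prop := WindowRegular
/-- Alias of `HarvestInputs` keyed by the registered stub name. -/
abbrev stub_harvestInputs : Prop := HarvestInputs
/-- Alias of `AbstractHarvest` keyed by the registered stub name. -/
abbrev stub_abstractHarvest : Prop := AbstractHarvest
/-- Alias of `Assembly` keyed by the registered stub name. -/
abbrev stub_assembly : Prop := Assembly

end Registered

/-! ### The composition: the seven stubs imply the crux, by name -/

/-- The common tail of both compositions, `VarianceBound → RungOneAdjacentMerging`, wrapped in a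
name so that the skeleton audit does not mistake its proof for the skeleton theorem. -/
def RungOneOfVariance : Prop := VarianceBound → RungOneAdjacentMerging

/-- A variance bound, the box passage and Chebyshev give the crux (pure logic:
`η := ε/2 < θ := ε`). -/
theorem rungOne_of_varianceBound (hcheb : MeanOneChebyshev) (hbox : BoxPassage) :
    RungOneOfVariance := by
  intro hvar ε hε
  obtain ⟨R, hR⟩ := hvar (ε / 2) (half_pos hε)
  refine ⟨R, fun x hx => ?_⟩
  obtain ⟨n₀, hn₀⟩ := hbox x (ε / 2) ε (half_pos hε) (half_lt_self hε) (hR x hx)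
  refine ⟨n₀, fun n hn o a y y' ho ha hy hy' => ?_⟩
  exact hcheb (↥(box 3 n)) ((zdGraph 3).comap (Subtype.val : ↥(box 3 n) → Site 3))
    (criticalBeta 3) (criticalBeta_nonneg 3) ε hε.le o a y y' (hn₀ n hn o a y y' ho ha hy hy')

/-- `RungOneAdjacentMerging` from the seven stubs of the line (kernel-checked, no `sorry`): STUB 6 fed
with STUBS 3, 4 and the harvest (STUBS 5a + 5b through `shareHarvest_of`) gives the variance bound;
STUB 2 moves it into the box; STUB 1 is Chebyshev. -/
theorem RungOneAdjacentMerging_of (h1 : Registered.stub_chebyshev) (h2 : Registered.stub_boxPassage)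
    (h3 : Registered.stub_cells) (h4 : Registered.stub_windowRegular)
    (h5a : Registered.stub_harvestInputs) (h5b : Registered.stub_abstractHarvest)
    (h6 : Registered.stub_assembly) : RungOneAdjacentMerging :=
  rungOne_of_varianceBound h1 h2 (h6 h3 h4 (shareHarvest_of h5a h5b))

/-! ### Wiring checks -/

/-- The registered stubs feed `RungOneAdjacentMerging_of` as stated (the crux is the route's
declaration, by name). -/
example : Summit.CriticalPhenomena.Ising3DConformalLimit.Theses.EnergyNotSigmaSquared.RungOneAdjacentMerging :=
  RungOneAdjacentMerging_of stub_chebyshev stub_boxPassage stub_cells stub_windowRegular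
    stub_harvestInputs stub_abstractHarvest stub_assembly

end Summit.CriticalPhenomena.Ising3DConformalLimit.RungOneAdjacentMergingDominantShell

end
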